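import Summits.QuantumFields.BalabanUV.T4Continuum.Support.NE7K1LinHomKernelSums

/-!
# NE7K1LinHomKernelBond — row NE7 (node U5), candidate route HOM, path H1L, cell K1-lin(s): the BOND KERNEL's values and ABSOLUTE
# ROW ∕ COLUMN SUMS (`α₀ = 3`, `α₁ = 5∕3`) — the one-dimensional half of the Schur test for the homogenised lift

Lineage `b2b-balaban-t4-ne7-p2` (CRUX PROVER NE7 #2), generation 66; continues `NE7K1LinHomKernel` ∕ `NE7K1LinHomKernelSums`.  The bond
kernel `b(t,Y) = cum(t+1,Y) − cum(t,Y)` is the Abel partial sum that multiplies the coarse GRADIENT `V(Y) − V(Y+1)` in the fine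
increment of the lift.  All [folklore]:

* §6 values: on an INTERIOR bond (`t = LX + j`, `j + 1 < L`) `b = [1≤X](ℓ_{j+1} − ℓ_j)∕2` at `Y = X−1`, `−[X+1<N](r_{j+1} − r_j)∕2`
  at `Y = X`, else `0` (`bondF_int_val`); on the FACE bond (`j = L−1`, `X+1 < N`) `−[1≤X]ℓ_{L−1}∕2`, `ℓ_0 − 1`, `−[X+2<N]ℓ_{L−1}∕2`
  at `Y = X−1, X, X+1` (`bondF_face_val`) — every value `O(1∕L)`.
* §7 ROW SUM `L·Σ_Y |b(t,Y)| ≤ 3` (`bondF_row_abs`: interior `(|6j+6−4L| + |6j+6−2L|)∕(2L) ≤ (3L−3)∕L`, face `(3L−2)∕L`) and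
  COLUMN SUM `Σ_t |b(t,Y)| ≤ 5∕3` (`bondF_col_abs`: `(Σ_{j<L−1}|6j+6−4L| + (L−1) + (2L−1))∕L² ≤ (20L² − 6)∕(12L²)` by the sharp
  increment sum).

HONEST FRAMING: elementary real analysis of ONE explicit piecewise-quadratic kernel on `ℤ` ([folklore]); no lattice field, no
operator of Bałaban's; it serves the homogenised upper two-run constant of `NE7K1LinHomUpper` (Gaussian `A = 0`, one RG step,
`U = 1`).  FIXED FINITE T⁴, rung (B)+1; NE7 NOT PRINTED ∕ NOT PROVED; spine 0∕9; NOT infinite volume, NOT mass gap, NOT Clay.  HONEST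
DEPENDENCY: continuum YM on T⁴ ⇐ BetaPertH ∧ nine spine estimates (0/9 proved); BetaPertH ⇐ (D1) ∧ (D4) ∧ CAP+tail; G-an2-4 gates
asym, D1 and NE2/3/4.
-/

noncomputable section

open Finset

namespace Summit.QuantumFields.BalabanUV.T4Continuum.NE7K1LinHomKernelBond

open NE7K1LinHomKernel NE7K1LinHomKernelSums

/-! ### §6 The bond kernel: support, values, row and column absolute sums -/

section Bond

variable {N L : ℕ}

/-- `r_{L−1} = ℓ_0`. [folklore] -/
theorem shapeR_last (L : ℕ) : shapeR L ((L : ℤ) - 1) = shapeL L 0 := by simp [shapeR]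

/-- `r_0 = ℓ_{L−1}`. [folklore] -/
theorem shapeR_zero (L : ℕ) : shapeR L 0 = shapeL L ((L : ℤ) - 1) := by simp [shapeR]

/-- an INTERIOR fine bond `(LX + j, LX + j + 1)`, `j + 1 < L`, of block `0 ≤ X < N` lies in the fine segment. [folklore] -/
theorem mem_bond_int {X j : ℤ} (hX0 : 0 ≤ X) (hXN : X < N) (hj0 : 0 ≤ j) (hjL : j + 1 < L) :
    0 ≤ (L : ℤ) * X + j ∧ (L : ℤ) * X + j + 1 < N * L := by
  refine ⟨by positivity, ?_⟩
  have h1 : X + 1 ≤ (N : ℤ) := by omega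
  nlinarith

/-- the FACE bond `(LX + L − 1, L(X+1))` between blocks `X` and `X + 1 < N` lies in the fine segment. [folklore] -/
theorem mem_bond_face (hL : 1 ≤ L) {X : ℤ} (hX0 : 0 ≤ X) (hXN : X + 1 < N) :
    0 ≤ (L : ℤ) * X + ((L : ℤ) - 1) ∧ (L : ℤ) * X + ((L : ℤ) - 1) + 1 < N * L := by
  have hL0 : (1 : ℤ) ≤ L := by exact_mod_cast hL
  refine ⟨by nlinarith, ?_⟩
  have h1 : X + 2 ≤ (N : ℤ) := by omega
  nlinarith

/-- INTERIOR BOND VALUES: `b(LX + j, Y)` for `j + 1 < L` is `[1 ≤ X]·(ℓ_{j+1} − ℓ_j)∕2` at `Y = X − 1`,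
`−[X+1 < N]·(r_{j+1} − r_j)∕2` at `Y = X`, and `0` elsewhere. [folklore] -/
theorem bondF_int_val {X j Y : ℤ} (hX0 : 0 ≤ X) (hXN : X < N) (hj0 : 0 ≤ j) (hjL : j + 1 < L) :
    bondF N L (L * X + j) Y =
      (if Y = X - 1 then (if 1 ≤ X then (1 : ℝ) else 0) * ((shapeL L (j + 1) - shapeL L j) / 2) else 0) +
      (if Y = X then -((if X + 1 < N then (1 : ℝ) else 0) * ((shapeR L (j + 1) - shapeR L j) / 2)) else 0) := by
  rw [bondF, if_pos (mem_bond_int hX0 hXN hj0 hjL)]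
  have et : (L : ℤ) * X + j + 1 = L * X + (j + 1) := by ring
  rw [et]
  by_cases h1 : Y = X - 1
  · rw [if_pos h1, if_neg (show ¬ Y = X by omega), add_zero, h1]
    by_cases h : 1 ≤ X
    · rw [if_pos h, cumF_pred (by omega) hjL h hXN, cumF_pred hj0 (by omega) h hXN]; ring
    · rw [if_neg h, cumF_of_neg _ (by omega), cumF_of_neg _ (by omega)]; ring
  by_cases h2 : Y = X
  · rw [if_neg h1, if_pos h2, zero_add, h2]
    by_cases h : X + 1 < N
    · rw [if_pos h, cumF_self (by omega) hjL hX0 h, cumF_self hj0 (by omega) hX0 h]; ring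
    · rw [if_neg h, cumF_of_last_le _ hX0 (by omega), cumF_of_last_le _ hX0 (by omega)]; ring
  rw [if_neg h1, if_neg h2, add_zero]
  rcases lt_or_gt_of_ne h2 with h | h
  · rw [cumF_of_le_sub_two (by omega) hjL hXN (show Y ≤ X - 2 by omega),
      cumF_of_le_sub_two hj0 (by omega) hXN (show Y ≤ X - 2 by omega), sub_self]
  · rw [cumF_of_succ_le hjL hX0 (show X + 1 ≤ Y by omega), cumF_of_succ_le (by omega) hX0 (show X + 1 ≤ Y by omega),
      sub_self]

/-- FACE BOND VALUES: `b(LX + L − 1, Y)` (`X + 1 < N`) is `−[1 ≤ X]·ℓ_{L−1}∕2` at `Y = X − 1`, `ℓ_0 − 1` at `Y = X`,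
`−[X + 2 < N]·ℓ_{L−1}∕2` at `Y = X + 1`, and `0` elsewhere. [folklore] -/
theorem bondF_face_val (hL : 1 ≤ L) {X Y : ℤ} (hX0 : 0 ≤ X) (hXN : X + 1 < N) :
    bondF N L (L * X + ((L : ℤ) - 1)) Y =
      (if Y = X - 1 then -((if 1 ≤ X then (1 : ℝ) else 0) * (shapeL L ((L : ℤ) - 1) / 2)) else 0) +
      (if Y = X then shapeL L 0 - 1 else 0) +
      (if Y = X + 1 then -((if X + 2 < N then (1 : ℝ) else 0) * (shapeL L ((L : ℤ) - 1) / 2)) else 0) := by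
  rw [bondF, if_pos (mem_bond_face hL hX0 hXN)]
  have hL0 : (0 : ℤ) < L := by exact_mod_cast hL
  have hj0 : (0 : ℤ) ≤ (L : ℤ) - 1 := by omega
  have hjL : (L : ℤ) - 1 < L := by omega
  -- the four values of `cum` at the first site of block `X + 1`
  have et : (L : ℤ) * X + ((L : ℤ) - 1) + 1 = L * (X + 1) + 0 := by ring
  have hA : ∀ Y', Y' ≤ X - 1 → cumF N L (L * X + ((L : ℤ) - 1) + 1) Y' = 0 := fun Y' hY' => by
    rw [et]; exact cumF_of_le_sub_two (X := X + 1) le_rfl hL0 hXN (by omega)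
  have hB : cumF N L (L * X + ((L : ℤ) - 1) + 1) X = shapeL L 0 / 2 := by
    have hp := cumF_pred (N := N) (L := L) (X := X + 1) (j := 0) le_rfl hL0 (by omega) hXN
    rw [show X + 1 - 1 = X by ring] at hp
    rw [et, hp]
  have hC : cumF N L (L * X + ((L : ℤ) - 1) + 1) (X + 1) = 1 - (if X + 2 < N then (1 : ℝ) else 0) * (shapeR L 0 / 2) := by
    rw [et]
    by_cases h : X + 2 < N
    · rw [if_pos h, cumF_self le_rfl hL0 (by omega) (by omega), one_mul]
    · rw [if_neg h, cumF_of_last_le _ (by omega) (by omega), zero_mul, sub_zero]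
  have hD : ∀ Y', X + 2 ≤ Y' → cumF N L (L * X + ((L : ℤ) - 1) + 1) Y' = 1 := fun Y' hY' => by
    rw [et]; exact cumF_of_succ_le hL0 (by omega) (by omega)
  by_cases h1 : Y = X - 1
  · rw [if_pos h1, if_neg (show ¬ Y = X by omega), if_neg (show ¬ Y = X + 1 by omega), add_zero, add_zero,
      hA Y (by omega), h1]
    by_cases h : 1 ≤ X
    · rw [if_pos h, cumF_pred hj0 hjL h (by omega)]; ring
    · rw [if_neg h, cumF_of_neg _ (by omega)]; ring
  by_cases h2 : Y = X
  · rw [if_neg h1, if_pos h2, if_neg (show ¬ Y = X + 1 by omega), zero_add, add_zero, h2, hB,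
      cumF_self hj0 hjL hX0 hXN, shapeR_last]
    ring
  by_cases h3 : Y = X + 1
  · rw [if_neg h1, if_neg h2, if_pos h3, zero_add, zero_add, h3, hC, cumF_of_succ_le hjL hX0 le_rfl, shapeR_zero]
    ring
  rw [if_neg h1, if_neg h2, if_neg h3, add_zero, add_zero]
  rcases lt_or_gt_of_ne h2 with h | h
  · rw [hA Y (by omega), cumF_of_le_sub_two hj0 hjL (by omega) (show Y ≤ X - 2 by omega), sub_self]
  · rw [hD Y (by omega), cumF_of_succ_le hjL hX0 (show X + 1 ≤ Y by omega), sub_self]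

end Bond


/-! ### §7 Row and column absolute sums of the bond kernel -/

section BondSums

variable {N L : ℕ}

/-- the interior increment inequality: `|6j + 6 − 4L| + |6j + 6 − 2L| ≤ 6L − 6` for `0 ≤ j ≤ L − 2`. [folklore] -/
theorem abs_incr_add_le {j l : ℝ} (hj0 : 0 ≤ j) (hjl : j + 2 ≤ l) :
    |6 * j + 6 - 4 * l| + |6 * j + 6 - 2 * l| ≤ 6 * l - 6 := by
  rcases abs_cases (6 * j + 6 - 4 * l) with ⟨h1, _⟩ | ⟨h1, _⟩ <;>
    rcases abs_cases (6 * j + 6 - 2 * l) with ⟨h2, _⟩ | ⟨h2, _⟩ <;> rw [h1, h2] <;> linarith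

/-- `|[P]·x| ≤ |x|` for an indicator `[P] ∈ {0,1}`. [folklore] -/
theorem abs_ite_mul_le (P : Prop) [Decidable P] (x : ℝ) : |(if P then (1 : ℝ) else 0) * x| ≤ |x| := by
  split_ifs <;> simp

/-- **ROW SUM OF THE BOND KERNEL**: `L·Σ_{Y<N} |b(t, Y)| ≤ 3` at every fine bond `t = LX + j`, `t + 1 < NL` (`α₀ = 3`).
[folklore] -/
theorem bondF_row_abs (hL : 1 ≤ L) {X j : ℤ} (hX0 : 0 ≤ X) (hXN : X < N) (hj0 : 0 ≤ j) (hjL : j < L)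
    (hb : (L : ℤ) * X + j + 1 < N * L) :
    (L : ℝ) * ∑ Y ∈ range N, |bondF N L (L * X + j) Y| ≤ 3 := by
  have hLr : (1 : ℝ) ≤ L := by exact_mod_cast hL
  have hL2 : (0 : ℝ) < (L : ℝ) ^ 2 := by positivity
  rw [sum_range_cast (fun Y => |bondF N L (L * X + j) Y|) N]
  by_cases hint : j + 1 < L
  · -- interior bond
    have hfar : ∀ Y : ℤ, Y ≠ X - 1 → Y ≠ X → Y ≠ X + 1 → bondF N L (L * X + j) Y = 0 := fun Y h1 h2 _ => by
      rw [bondF_int_val hX0 hXN hj0 hint, if_neg h1, if_neg h2, add_zero]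
    have h3 := sum_abs_le_three ((range N).image (Nat.cast : ℕ → ℤ)) _ X hfar
    have vm : bondF N L (L * X + j) (X - 1) = (if 1 ≤ X then (1 : ℝ) else 0) * ((shapeL L (j + 1) - shapeL L j) / 2) := by
      rw [bondF_int_val hX0 hXN hj0 hint, if_pos rfl, if_neg (show ¬ X - 1 = X by omega), add_zero]
    have v0 : bondF N L (L * X + j) X = -((if X + 1 < N then (1 : ℝ) else 0) * ((shapeR L (j + 1) - shapeR L j) / 2)) := by
      rw [bondF_int_val hX0 hXN hj0 hint, if_neg (show ¬ X = X - 1 by omega), if_pos rfl, zero_add]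
    have vp : bondF N L (L * X + j) (X + 1) = 0 := by
      rw [bondF_int_val hX0 hXN hj0 hint, if_neg (show ¬ X + 1 = X - 1 by omega), if_neg (show ¬ X + 1 = X by omega),
        add_zero]
    rw [vm, v0, vp, abs_zero, add_zero, abs_neg, shapeL_succ_sub hL, shapeR_succ_sub hL] at h3
    have e1 := abs_ite_mul_le (1 ≤ X) ((6 * (j : ℝ) + 6 - 4 * L) / (L : ℝ) ^ 2 / 2)
    have e2 := abs_ite_mul_le (X + 1 < N) ((6 * (j : ℝ) + 6 - 2 * L) / (L : ℝ) ^ 2 / 2)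
    rw [abs_div, abs_div, abs_of_pos hL2, abs_two] at e1 e2
    have key := abs_incr_add_le (j := (j : ℝ)) (l := (L : ℝ)) (by exact_mod_cast hj0)
      (by have : j + 2 ≤ (L : ℤ) := by omega
          exact_mod_cast this)
    have hsum : ∑ Y ∈ (range N).image (Nat.cast : ℕ → ℤ), |bondF N L (L * X + j) Y| ≤
        (|6 * (j : ℝ) + 6 - 4 * L| + |6 * (j : ℝ) + 6 - 2 * L|) / (L : ℝ) ^ 2 / 2 := by
      have := h3.trans (add_le_add e1 e2); rw [← add_div, ← add_div] at this; exact this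
    calc (L : ℝ) * ∑ Y ∈ (range N).image (Nat.cast : ℕ → ℤ), |bondF N L (L * X + j) Y|
        ≤ (L : ℝ) * ((6 * L - 6) / (L : ℝ) ^ 2 / 2) := by
          refine mul_le_mul_of_nonneg_left (hsum.trans ?_) (by positivity)
          gcongr
      _ ≤ 3 := by
          rw [div_div, pow_two, show (L : ℝ) * ((6 * L - 6) / ((L : ℝ) * L * 2)) = (6 * L - 6) / (L * 2) by
            field_simp]
          rw [div_le_iff₀ (by positivity)]
          linarith
  · -- face bond
    have hjL' : j = (L : ℤ) - 1 := by omega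
    subst hjL'
    have hXN' : X + 1 < N := by
      by_contra h
      have h' : (N : ℤ) ≤ X + 1 := by omega
      have : (N : ℤ) * L ≤ (L : ℤ) * X + ((L : ℤ) - 1) + 1 := by nlinarith
      omega
    have hfar : ∀ Y : ℤ, Y ≠ X - 1 → Y ≠ X → Y ≠ X + 1 → bondF N L (L * X + ((L : ℤ) - 1)) Y = 0 := fun Y h1 h2 h3 => by
      rw [bondF_face_val hL hX0 hXN', if_neg h1, if_neg h2, if_neg h3, add_zero, add_zero]
    have h3 := sum_abs_le_three ((range N).image (Nat.cast : ℕ → ℤ)) _ X hfar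
    have vm : bondF N L (L * X + ((L : ℤ) - 1)) (X - 1) =
        -((if 1 ≤ X then (1 : ℝ) else 0) * (shapeL L ((L : ℤ) - 1) / 2)) := by
      rw [bondF_face_val hL hX0 hXN', if_pos rfl, if_neg (show ¬ X - 1 = X by omega),
        if_neg (show ¬ X - 1 = X + 1 by omega), add_zero, add_zero]
    have v0 : bondF N L (L * X + ((L : ℤ) - 1)) X = shapeL L 0 - 1 := by
      rw [bondF_face_val hL hX0 hXN', if_neg (show ¬ X = X - 1 by omega), if_pos rfl, if_neg (show ¬ X = X + 1 by omega),
        zero_add, add_zero]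
    have vp : bondF N L (L * X + ((L : ℤ) - 1)) (X + 1) =
        -((if X + 2 < N then (1 : ℝ) else 0) * (shapeL L ((L : ℤ) - 1) / 2)) := by
      rw [bondF_face_val hL hX0 hXN', if_neg (show ¬ X + 1 = X - 1 by omega), if_neg (show ¬ X + 1 = X by omega), if_pos rfl,
        zero_add, zero_add]
    rw [vm, v0, vp, abs_neg, abs_neg] at h3
    have e1 := abs_ite_mul_le (1 ≤ X) (shapeL L ((L : ℤ) - 1) / 2)
    have e2 := abs_ite_mul_le (X + 2 < N) (shapeL L ((L : ℤ) - 1) / 2)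
    have hlast : |shapeL L ((L : ℤ) - 1) / 2| = ((L : ℝ) - 1) / (L : ℝ) ^ 2 / 2 := by
      rw [shapeL_last hL, abs_div, abs_div, abs_of_pos hL2, abs_two, abs_of_nonpos (by linarith)]; ring
    have hzero : |shapeL L 0 - 1| = (2 * (L : ℝ) - 1) / (L : ℝ) ^ 2 := by
      rw [abs_sub_comm, one_sub_shapeL_zero hL, abs_of_nonneg (div_nonneg (by linarith) hL2.le)]
    rw [hlast] at e1 e2
    rw [hzero] at h3
    have hsum := h3.trans (add_le_add (add_le_add e1 le_rfl) e2)
    calc (L : ℝ) * ∑ Y ∈ (range N).image (Nat.cast : ℕ → ℤ), |bondF N L (L * X + ((L : ℤ) - 1)) Y|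
        ≤ (L : ℝ) * (((L : ℝ) - 1) / (L : ℝ) ^ 2 / 2 + (2 * (L : ℝ) - 1) / (L : ℝ) ^ 2 + ((L : ℝ) - 1) / (L : ℝ) ^ 2 / 2) :=
          mul_le_mul_of_nonneg_left hsum (by positivity)
      _ = (3 * L - 2) / L := by field_simp; ring
      _ ≤ 3 := by rw [div_le_iff₀ (by positivity)]; linarith

/-- a fine site `LX + j` with `X` outside `[0,N)` carries no bond of the fine segment. [folklore] -/
theorem not_mem_bond {X : ℤ} (hX : ¬ (0 ≤ X ∧ X < N)) {j : ℕ} (hjL : j < L) :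
    ¬ (0 ≤ (L : ℤ) * X + j ∧ (L : ℤ) * X + j + 1 < N * L) := by
  intro h
  apply hX
  constructor
  · by_contra hX0
    have : (L : ℤ) * X + j < 0 := by nlinarith
    omega
  · by_contra hXN
    have : (N : ℤ) * L ≤ (L : ℤ) * X + j := by nlinarith
    omega

/-- a bond block sum vanishes outside the segment. [folklore] -/
theorem blockSum_bondF_out {Y X : ℤ} (hX : ¬ (0 ≤ X ∧ X < N)) :
    ∑ j ∈ range L, |bondF N L (L * X + j) Y| = 0 := by
  refine Finset.sum_eq_zero fun j hj => ?_
  rw [abs_eq_zero]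
  exact bondF_of_not_mem (not_mem_bond hX (Finset.mem_range.1 hj)) Y

/-- splitting a block sum into the interior offsets and the last one. [folklore] -/
theorem sum_range_split_last (hL : 1 ≤ L) (f : ℕ → ℝ) :
    ∑ j ∈ range L, f j = ∑ j ∈ range (L - 1), f j + f (L - 1) := by
  have h : range L = range (L - 1 + 1) := by rw [Nat.sub_add_cancel hL]
  rw [h, Finset.sum_range_succ]

/-- the face term of a block: at offset `L − 1` the bond kernel is the face value if `X + 1 < N` and `0` otherwise. [folklore] -/
theorem bondF_lastOffset_of_top (hL : 1 ≤ L) {X : ℤ} (hXN : ¬ (X + 1 < N)) (Y : ℤ) :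
    bondF N L (L * X + ((L - 1 : ℕ) : ℤ)) Y = 0 := by
  refine bondF_of_not_mem (fun h => hXN ?_) Y
  have e : ((L - 1 : ℕ) : ℤ) = (L : ℤ) - 1 := by omega
  rw [e] at h
  have hL0 : (0 : ℤ) < L := by exact_mod_cast hL
  nlinarith [h.2]

/-- a bond block sum vanishes off the three neighbouring blocks. [folklore] -/
theorem blockSum_bondF_far (hL : 1 ≤ L) {Y X : ℤ} (h1 : X ≠ Y - 1) (h2 : X ≠ Y) (h3 : X ≠ Y + 1) :
    ∑ j ∈ range L, |bondF N L (L * X + j) Y| = 0 := by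
  by_cases hX : 0 ≤ X ∧ X < N
  · rw [sum_range_split_last hL]
    have hint : ∑ j ∈ range (L - 1), |bondF N L (L * X + (j : ℕ)) Y| = 0 := by
      refine Finset.sum_eq_zero fun j hj => ?_
      have hjL := Finset.mem_range.1 hj
      rw [abs_eq_zero, bondF_int_val hX.1 hX.2 (by positivity) (by omega), if_neg (show ¬ Y = X - 1 by omega),
        if_neg (show ¬ Y = X by omega), add_zero]
    rw [hint, zero_add, abs_eq_zero]
    by_cases htop : X + 1 < N
    · have e : ((L - 1 : ℕ) : ℤ) = (L : ℤ) - 1 := by omega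
      rw [e, bondF_face_val hL hX.1 htop, if_neg (show ¬ Y = X - 1 by omega), if_neg (show ¬ Y = X by omega),
        if_neg (show ¬ Y = X + 1 by omega), add_zero, add_zero]
    · exact bondF_lastOffset_of_top hL htop Y
  · exact blockSum_bondF_out hX

/-- reflecting the interior increments: `Σ_{j<L−1} |6j + 6 − 2L| = Σ_{j<L−1} |6j + 6 − 4L|`. [folklore] -/
theorem sum_abs_incr_reflect (L : ℕ) :
    ∑ j ∈ range (L - 1), |6 * (j : ℝ) + 6 - 2 * L| = ∑ j ∈ range (L - 1), |6 * (j : ℝ) + 6 - 4 * L| := by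
  rw [← Finset.sum_range_reflect (fun j => |6 * (j : ℝ) + 6 - 4 * L|) (L - 1)]
  refine Finset.sum_congr rfl fun j hj => ?_
  have hjL := Finset.mem_range.1 hj
  have e : ((L - 1 - 1 - j : ℕ) : ℝ) = (L : ℝ) - 2 - j := by
    have : ((L - 1 - 1 - j : ℕ) : ℤ) = (L : ℤ) - 2 - j := by omega
    exact_mod_cast this
  simp only [e]
  rw [abs_sub_comm]
  congr 1
  ring

/-- **COLUMN SUM OF THE BOND KERNEL**: `Σ_{t<NL} |b(t, Y)| ≤ 5∕3` at every coarse site `0 ≤ Y < N` (`α₁ = 5∕3`; the bound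
is `(20L² − 6)∕(12L²)` from the sharp increment sum and the exact face values). [folklore] -/
theorem bondF_col_abs (hL : 1 ≤ L) {Y : ℤ} (hY0 : 0 ≤ Y) (hYN : Y < N) :
    ∑ t ∈ range (N * L), |bondF N L t Y| ≤ 5 / 3 := by
  have hLr : (1 : ℝ) ≤ L := by exact_mod_cast hL
  have hL2 : (0 : ℝ) < (L : ℝ) ^ 2 := by positivity
  have ecast : ((L - 1 : ℕ) : ℤ) = (L : ℤ) - 1 := by omega
  rw [sum_range_mul (fun t => |bondF N L t Y|) N L]
  push_cast
  rw [sum_range_cast (fun X => ∑ j ∈ range L, |bondF N L (L * X + j) Y|)]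
  refine (sum_le_three _ _ Y (fun X => Finset.sum_nonneg fun _ _ => abs_nonneg _)
    (fun X h1 h2 h3 => blockSum_bondF_far hL h1 h2 h3)).trans ?_
  -- the block above: interior increments of `ℓ` and one face value
  have hup : ∑ j ∈ range L, |bondF N L (L * (Y + 1) + j) Y| ≤
      (∑ j ∈ range (L - 1), |6 * (j : ℝ) + 6 - 4 * L|) / (L : ℝ) ^ 2 / 2 + ((L : ℝ) - 1) / (L : ℝ) ^ 2 / 2 := by
    by_cases hX : Y + 1 < N
    · rw [sum_range_split_last hL, Finset.sum_div, Finset.sum_div]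
      refine add_le_add (Finset.sum_le_sum fun j hj => ?_) ?_
      · have hjL := Finset.mem_range.1 hj
        rw [bondF_int_val (X := Y + 1) (by omega) hX (by positivity) (by omega), if_pos (show Y = Y + 1 - 1 by ring),
          if_neg (show ¬ Y = Y + 1 by omega), add_zero, shapeL_succ_sub hL]
        refine (abs_ite_mul_le _ _).trans (le_of_eq ?_)
        rw [abs_div, abs_div, abs_of_pos hL2, abs_two]
        simp only [Int.cast_natCast]
      · by_cases htop : Y + 1 + 1 < N
        · rw [ecast, bondF_face_val hL (X := Y + 1) (by omega) htop, if_pos (show Y = Y + 1 - 1 by ring),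
            if_neg (show ¬ Y = Y + 1 by omega), if_neg (show ¬ Y = Y + 1 + 1 by omega), add_zero, add_zero, abs_neg]
          refine (abs_ite_mul_le _ _).trans (le_of_eq ?_)
          rw [shapeL_last hL, abs_div, abs_div, abs_of_pos hL2, abs_two, abs_of_nonpos (by linarith)]; ring
        · rw [bondF_lastOffset_of_top hL htop, abs_zero]; positivity
    · rw [blockSum_bondF_out (X := Y + 1) (by omega)]
      have : 0 ≤ (∑ j ∈ range (L - 1), |6 * (j : ℝ) + 6 - 4 * L|) := Finset.sum_nonneg fun _ _ => abs_nonneg _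
      positivity
  -- the own block: interior increments of `r` and one face value
  have hself : ∑ j ∈ range L, |bondF N L (L * Y + j) Y| ≤
      (∑ j ∈ range (L - 1), |6 * (j : ℝ) + 6 - 2 * L|) / (L : ℝ) ^ 2 / 2 + (2 * (L : ℝ) - 1) / (L : ℝ) ^ 2 := by
    rw [sum_range_split_last hL, Finset.sum_div, Finset.sum_div]
    refine add_le_add (Finset.sum_le_sum fun j hj => ?_) ?_
    · have hjL := Finset.mem_range.1 hj
      rw [bondF_int_val (X := Y) hY0 hYN (by positivity) (by omega), if_neg (show ¬ Y = Y - 1 by omega), if_pos rfl, zero_add,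
        abs_neg, shapeR_succ_sub hL]
      refine (abs_ite_mul_le _ _).trans (le_of_eq ?_)
      rw [abs_div, abs_div, abs_of_pos hL2, abs_two]
      simp only [Int.cast_natCast]
    · by_cases htop : Y + 1 < N
      · rw [ecast, bondF_face_val hL hY0 htop, if_neg (show ¬ Y = Y - 1 by omega), if_pos rfl,
          if_neg (show ¬ Y = Y + 1 by omega), zero_add, add_zero,
          abs_sub_comm, one_sub_shapeL_zero hL, abs_of_nonneg (div_nonneg (by linarith) hL2.le)]
      · rw [bondF_lastOffset_of_top hL htop, abs_zero]; exact div_nonneg (by linarith) hL2.le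
  -- the block below: only the face value
  have hdown : ∑ j ∈ range L, |bondF N L (L * (Y - 1) + j) Y| ≤ ((L : ℝ) - 1) / (L : ℝ) ^ 2 / 2 := by
    by_cases hX : 1 ≤ Y
    · rw [sum_range_split_last hL]
      have hint : ∑ j ∈ range (L - 1), |bondF N L (L * (Y - 1) + (j : ℕ)) Y| = 0 := by
        refine Finset.sum_eq_zero fun j hj => ?_
        have hjL := Finset.mem_range.1 hj
        rw [abs_eq_zero, bondF_int_val (X := Y - 1) (by omega) (by omega) (by positivity) (by omega),
          if_neg (show ¬ Y = Y - 1 - 1 by omega), if_neg (show ¬ Y = Y - 1 by omega), add_zero]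
      rw [hint, zero_add, ecast, bondF_face_val hL (X := Y - 1) (by omega) (by omega), if_neg (show ¬ Y = Y - 1 - 1 by omega),
        if_neg (show ¬ Y = Y - 1 by omega), if_pos (show Y = Y - 1 + 1 by ring), zero_add, zero_add, abs_neg]
      refine (abs_ite_mul_le _ _).trans (le_of_eq ?_)
      rw [shapeL_last hL, abs_div, abs_div, abs_of_pos hL2, abs_two, abs_of_nonpos (by linarith)]; ring
    · rw [blockSum_bondF_out (X := Y - 1) (by omega)]; exact div_nonneg (div_nonneg (by linarith) hL2.le) (by norm_num)
  rw [sum_abs_incr_reflect] at hself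
  have hincr := sum_abs_incr_le hL
  have hS : 0 ≤ ∑ j ∈ range (L - 1), |6 * (j : ℝ) + 6 - 4 * L| := Finset.sum_nonneg fun _ _ => abs_nonneg _
  -- assemble: total ≤ (S + (L−1) + (2L−1))∕L² ≤ ((20L² − 36L + 18)∕12 + 3L − 2)∕L² = (20L² − 6)∕(12L²) ≤ 5∕3
  set S := ∑ j ∈ range (L - 1), |6 * (j : ℝ) + 6 - 4 * L| with hSdef
  have h := add_le_add (add_le_add hdown hself) hup
  have e1 : ((L : ℝ) - 1) / (L : ℝ) ^ 2 / 2 + (S / (L : ℝ) ^ 2 / 2 + (2 * (L : ℝ) - 1) / (L : ℝ) ^ 2) +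
      (S / (L : ℝ) ^ 2 / 2 + ((L : ℝ) - 1) / (L : ℝ) ^ 2 / 2) = (S + 3 * L - 2) / (L : ℝ) ^ 2 := by
    field_simp
    ring
  rw [e1] at h
  refine h.trans ?_
  have e2 : (S + 3 * L - 2) / (L : ℝ) ^ 2 ≤ (((2 * (L : ℝ) - 3) ^ 2 + (4 * L - 3) ^ 2) / 12 + 3 * L - 2) / (L : ℝ) ^ 2 :=
    div_le_div_of_nonneg_right (by linarith) hL2.le
  refine e2.trans ?_
  rw [div_le_iff₀ hL2]
  nlinarith

end BondSums

end Summit.QuantumFields.BalabanUV.T4Continuum.NE7K1LinHomKernelBond
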